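import Summits.Ventures.PercRepro2.CaseOneStarPoly

/-!
# The gadget `u ~ {w, a₁, o}`, `w ~ {u, a₂, b}` (uwa1o): the linear-form atoms of the parts (part 1)
(blind cell PercRepro2, p1 g34; the fourth gadget anchor of the six-form calculus — all six forms of the uwa1o gadget
as plain SFacts-cone certificate chains, generated by mining/p1/g34/uwa1o/genu.py = p1 g33's gent_uwa1.py / g25's
geno.py re-targeted; P1-G33 §6–§6″, P1-G34)

Every part `pgAO{X} abc` of `CaseOneGadgetUWA1OParts` / `PartsB` / `PartsT` is `A + e₃ B + e₄ C + e₃ e₄ D` with `A, B, C, D` linear in the ten cells; these are the 95 distinct linear forms `ulfAO01 … ulfAO95` (split identities in `CaseOneGadgetUWA1OAtomSplit` / `AtomSplitT`) — this file: `ulfAO91 … ulfAO95`. The Bernstein files `CaseOneGadgetUWA1OCf*` expand the coefficients `cfAO* abc` cell by cell in these atoms, which keeps every kernel check small. -/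

namespace Summit.Ventures.PercRepro2

namespace CaseOne

section AtomsAO5B
variable {R : Type*} [CommRing R]

/-- Linear-form atom `ulfAO91` of the uwa1o parts: `-1 c1 + -1 c2 + 1 c4 + 1 c5 + 2 c7 + 1 c8 + -2 c10`. -/
def ulfAO91 (m : SCells R) : R :=
  (-1 : R) * m.c1 + (-1 : R) * m.c2 + (1 : R) * m.c4 + (1 : R) * m.c5 + (2 : R) * m.c7 + (1 : R) * m.c8 + (-2 : R) * m.c10

/-- Linear-form atom `ulfAO92` of the uwa1o parts: `1 c4 + 1 c5 + 1 c7 + 1 c8 + -1 c10`. -/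
def ulfAO92 (m : SCells R) : R :=
  (1 : R) * m.c4 + (1 : R) * m.c5 + (1 : R) * m.c7 + (1 : R) * m.c8 + (-1 : R) * m.c10

/-- Linear-form atom `ulfAO93` of the uwa1o parts: `-1 c2 + 1 c5 + 1 c7 + 1 c8`. -/
def ulfAO93 (m : SCells R) : R :=
  (-1 : R) * m.c2 + (1 : R) * m.c5 + (1 : R) * m.c7 + (1 : R) * m.c8

/-- Linear-form atom `ulfAO94` of the uwa1o parts: `-1 c1 + -1 c2 + 1 c3 + 1 c4 + 1 c5 + 1 c6 + 1 c7 + 1 c8 + -1 c9 + -1 c10`. -/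
def ulfAO94 (m : SCells R) : R :=
  (-1 : R) * m.c1 + (-1 : R) * m.c2 + (1 : R) * m.c3 + (1 : R) * m.c4 + (1 : R) * m.c5 + (1 : R) * m.c6 + (1 : R) * m.c7 + (1 : R) * m.c8 + (-1 : R) * m.c9 + (-1 : R) * m.c10

/-- Linear-form atom `ulfAO95` of the uwa1o parts: `1 c1 + 1 c2 + -1 c4 + -1 c5 + -2 c7 + -1 c8 + 2 c10`. -/
def ulfAO95 (m : SCells R) : R :=
  (1 : R) * m.c1 + (1 : R) * m.c2 + (-1 : R) * m.c4 + (-1 : R) * m.c5 + (-2 : R) * m.c7 + (-1 : R) * m.c8 + (2 : R) * m.c10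

end AtomsAO5B

end CaseOne

end Summit.Ventures.PercRepro2
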